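import Summits.QuantumFields.BalabanUV.Beta.GAN24.VolumeLimitLevelwise

/-!
# `BalabanUV.Beta.GAN24.BoundedBackgroundLegs` — binder row G-an2-4 ∕ (CONV-C), routes C-R6° («VALUES») × R7 («TWO CURRENCIES»), PART 213:
# THE LEGS OF A BOUNDED (NON-LIPSCHITZ) LOCALISED FAMILY — level envelope (L-UD) and the trivial step envelope at ratio `1` on every torus, EL₃ AT EACH LEVEL from EL₁ AT THAT
# LEVEL by the LEVEL-SLICE trick (the slice `k′ ↦ [k′ = k]·V^{(k)}` of a bounded tower IS a `LipschitzBackground α (2α·n_k)` and has the same level-`k` word), and the INDICATOR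
# 1-forms `[μ = x₂]·𝟙[ρ_{k,x}(u) ≤ 0]` (row an1's coordinate backgrounds, census V202′ (b)): bounded by `1`, supported where `ρ ≤ 0`, pointwise limits about every integer root
# (unit b2b-balaban-gan24-p3, gen 63; v1)

NOT IN PRINT; OUR PROOF ([folklore] bookkeeping BY NAME over PART 198 (`exists_twoPoint_insertion` — no smoothness), PART 200 (`insertionLegs_tendsto`), PART 202 (`ctr_unitIdx_symm_castT`,
`unitIdx_symm_snd`), PART 192 (`tdist_castT_eventually`), NE2's `FirstOrderBackgroundModel.LipschitzBackground ∕ Pmodel`, `CovariantAveragingTower.avgTow`; [Balaban1987RG1] (1.20)–(1.22)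
p. 264 LOCATE the one-loop shapes; nothing printed is a hypothesis).
HONEST FRAMING (cell contract, verbatim): «discharging `BetaPertH` makes Bałaban's UV stability UNCONDITIONAL — a real constructive-QFT result; it is NOT the
continuum limit and NOT the Clay problem.»  HONEST DEPENDENCY (verbatim): «continuum YM on T⁴ ⇐ BetaPertH ∧ nine spine estimates (0/9 proved); BetaPertH ⇐
(D1) ∧ (D4) ∧ CAP+tail; G-an2-4 gates asym, D1 and NE2/3/4.»

WHY (census V202′ (b)).  The indicator family is bounded and localised but not Lipschitz at its own spacing (unit jumps across the block faces), so PART 200's leg supply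
(`insertionLegs_envelopes ∕ _tendsto`, both stated for `LipschitzBackground`s) does not apply verbatim.  Two of its three clauses need no smoothness: (L-UD) is PART 198 §3 for
bounded localised backgrounds; EL₃ at level `k` depends on the background through its level-`k` slice only (`avgTow … X k = L^{dk}·Q_kX_kQ_kᴴ`, `Pmodel V k = Σ_μ diag(V^{(k)}_μ)∇^{(k)}_μ`),
and the slice of a bounded tower is Lipschitz with the level-dependent constant `2α·n_k` — harmless for a fixed-level volume limit.  The third clause (L-SR) is replaced by the
trivial ratio-`1` step envelope `2B` (PART 212's currency); the geometric (L-SR) for indicators stays the located analysis item.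

WHAT THIS FILE PROVES (0 sorry, 0 `def`; `M_t = fine (Lb·1) (cubic (d+1) (s t))`, `X_{t,x,k}` the insertion word of `V_{t,x}`):
* §1 `avgTow_congr_level`, `Pmodel_slice`, **`lipschitzBackground_slice`** (`‖V‖ ≤ α` ⟹ the level-`k₀` slice is a `LipschitzBackground … α (2α·n_{k₀})`), `word_slice` (same level-`k₀` word).
* §2 **`boundedLegs_envelopes`** — (`‖V_{t,x}‖ ≤ α`, supported where `ρ_{k,x} ≤ c₀`; every coarse volume family) `∃ κ > 0, B ≥ 0`: level envelope `B·e^{−κ(distK x q + distK x r)}` and step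
  envelope `2B·1^k·e^{−κ(…)}` of the legs `Γ_{t,k}(x,(q,r)) = X_{t,x,k}(q,r)`.
* §3 **`boundedLegs_tendsto`** — (`d + 1 ≥ 3`, coarse volumes `2(t+1)`) EL₃ of the legs at level `k` from EL₁ of the bounded backgrounds AT LEVEL `k` about every integer root.
* §4 the INDICATOR family `V_{t,x}^{(k)}(u)_μ = [μ = x₂]·𝟙[ρ_{k,x}(u) ≤ 0]` (DISPLAYED as a hypothesis `hVdef`, no definition): `indicator_bound` (`≤ 1`), `indicator_loc` (`≠ 0 ⟹ ρ ≤ 0`),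
  **`tendsto_indicator_reading`** (EL₁ about every integer root at every level, any cubic side sequence: eventually constant).
WHAT IT DOES NOT DO: the geometric step envelope (L-SR) for bounded ∕ indicator backgrounds (analysis item); the towers (PART 214).
SUPPLIER work; NEVER «G-an2-4 closed»; NOT (CONV-C), NOT D1, NOT `BetaPertH`, NOT continuum, NOT Clay.  Records: `HOME/b2b-balaban-gan24-p3/gen63/README.md`.
-/

noncomputable section

open scoped BigOperators ComplexConjugate Matrix Matrix.Norms.L2Operator Kronecker
open Filter Topology Finset Matrix

namespace Summit.QuantumFields.BalabanUV.Beta.GAN24.BoundedBackgroundLegs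

open Literature.MathematicalPhysics.QuantumFieldTheory.Balaban1983to89
open Literature.MathematicalPhysics.QuantumFieldTheory.Balaban1983to89.B5Prop11Plancherel (Tor fine)
open Literature.MathematicalPhysics.QuantumFieldTheory.Balaban1983to89.B5G183RateUnitTower (lev)
open Literature.MathematicalPhysics.QuantumFieldTheory.Balaban1983to89.Beta.FreeLegDictionary (cubic)
open Literature.MathematicalPhysics.QuantumFieldTheory.Balaban1983to89.Beta.BlockKernelVolumeSockets (evenPeriod tendsto_evenPeriod)
open Literature.MathematicalPhysics.QuantumFieldTheory.Balaban1983to89.Beta.VectorTails (castT)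
open Literature.MathematicalPhysics.QuantumFieldTheory.Balaban1983to89.Beta.VectorTailsCov (tdist)
open Literature.MathematicalPhysics.QuantumFieldTheory.Balaban1983to89.Beta.PoissonInterior (supNorm)
open Summit.QuantumFields.BalabanUV.T4Continuum.CovariantAveragingTower (avgTow)
open Summit.QuantumFields.BalabanUV.T4Continuum.BalabanAveragedTowerUnit (idx QBlev calGlev one_le_lev')
open Summit.QuantumFields.BalabanUV.T4Continuum.BalabanAveragedCoerciveTower (unitIdx)
open Summit.QuantumFields.BalabanUV.T4Continuum.CTKingTowerWeights (rho rhoSite ctr rho_apply distK distK_comm)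
open Summit.QuantumFields.BalabanUV.T4Continuum.FirstOrderBackgroundModel (LipschitzBackground Pmodel)
open Summit.QuantumFields.BalabanUV.Beta.GAN24.InsertionWordTwoPointDecay (exists_twoPoint_insertion)
open Summit.QuantumFields.BalabanUV.Beta.GAN24.OneStepLoopContractionLegs (insertionLegs_tendsto)
open Summit.QuantumFields.BalabanUV.Beta.GAN24.OneStepConstraintAxialDelKVolumeLimitDecay (tdist_castT_eventually)
open Summit.QuantumFields.BalabanUV.Beta.GAN24.TentBackgroundLegs (ctr_unitIdx_symm_castT unitIdx_symm_snd)

variable {d : ℕ} (L : ℕ) [NeZero L]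

/-! ## §1 The level slice of a bounded tower is a Lipschitz background with the same level word -/

section Slice

variable {D : ℕ} (M : Fin D → ℕ) [hM : ∀ μ, NeZero (M μ)]

omit [NeZero L] hM in
/-- `avgTow … X k` depends on the tower `X` through `X k` only. [folklore] -/
theorem avgTow_congr_level {ι : ℕ → Type*} [∀ k, Fintype (ι k)] [∀ k, DecidableEq (ι k)] (A : (k : ℕ) → Matrix (ι k) (ι (k + 1)) ℂ) (r : ℝ)
    {X X' : (k : ℕ) → Matrix (ι k) (ι k) ℂ} {k : ℕ} (h : X k = X' k) : avgTow A r X k = avgTow A r X' k := by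
  unfold avgTow; rw [h]

/-- the model perturbation at level `k₀` sees the level-`k₀` slice only. [folklore] -/
theorem Pmodel_slice (V : (k : ℕ) → Fin D → (idx L M k → ℂ)) (k₀ : ℕ) :
    Pmodel L M (fun k' μ u => if k' = k₀ then V k' μ u else 0) k₀ = Pmodel L M V k₀ := by
  unfold Pmodel
  congr 1
  funext μ u
  exact if_pos rfl

/-- the level-`k₀` insertion word of the slice is the level-`k₀` insertion word. [folklore] -/
theorem word_slice (a : ℝ) (ha : 0 < a) (V : (k : ℕ) → Fin D → (idx L M k → ℂ)) (k₀ : ℕ) :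
    avgTow (QBlev L M) ((L : ℝ) ^ D) (fun k => calGlev L M a ha k * Pmodel L M (fun k' μ u => if k' = k₀ then V k' μ u else 0) k * calGlev L M a ha k) k₀
      = avgTow (QBlev L M) ((L : ℝ) ^ D) (fun k => calGlev L M a ha k * Pmodel L M V k * calGlev L M a ha k) k₀ :=
  avgTow_congr_level _ _ (by rw [Pmodel_slice])

omit hM in
/-- **`lipschitzBackground_slice` — THE LEVEL SLICE OF A BOUNDED TOWER IS A LIPSCHITZ BACKGROUND** (`‖V‖ ≤ α`, `α ≥ 0`): `k′ ↦ [k′ = k₀]·V^{(k₀)}` has size `α`, is Lipschitz at its own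
spacing and two-spacing consistent with the LEVEL-DEPENDENT constant `β = 2α·n_{k₀}` (the only non-zero differences live at levels `k₀` and `k₀ ± 1`, where `β∕n_k ≥ 2α` resp. `≥ α`).
[folklore] -/
theorem lipschitzBackground_slice {V : (k : ℕ) → Fin D → (idx L M k → ℂ)} {α : ℝ} (hα : 0 ≤ α) (hVb : ∀ k μ u, ‖V k μ u‖ ≤ α) (k₀ : ℕ) :
    LipschitzBackground L M (fun k' μ u => if k' = k₀ then V k' μ u else 0) α (2 * α * (lev L k₀ : ℕ)) where
  nonneg := ⟨hα, by positivity⟩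
  bound k μ u := by
    show ‖(if k = k₀ then V k μ u else 0)‖ ≤ α
    split_ifs
    · exact hVb _ _ _
    · rw [norm_zero]; exact hα
  lipschitz k μ ν i := by
    have hpos : (0 : ℝ) < ((lev L k : ℕ) : ℝ) := by exact_mod_cast lt_of_lt_of_le zero_lt_one (one_le_lev' L k)
    show ‖(if k = k₀ then _ else 0) - (if k = k₀ then _ else 0)‖ ≤ _
    by_cases hk : k = k₀
    · subst hk
      rw [if_pos rfl, if_pos rfl, le_div_iff₀ hpos]
      calc ‖V k μ _ - V k μ i‖ * ((lev L k : ℕ) : ℝ) ≤ (α + α) * ((lev L k : ℕ) : ℝ) :=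
            mul_le_mul_of_nonneg_right ((norm_sub_le _ _).trans (add_le_add (hVb _ _ _) (hVb _ _ _))) hpos.le
        _ = 2 * α * ((lev L k : ℕ) : ℝ) := by ring
    · rw [if_neg hk, if_neg hk, sub_zero, norm_zero]; positivity
  consistent k μ i := by
    have hpos : (0 : ℝ) < ((lev L k : ℕ) : ℝ) := by exact_mod_cast lt_of_lt_of_le zero_lt_one (one_le_lev' L k)
    have hstep : ((lev L k : ℕ) : ℝ) ≤ ((lev L (k + 1) : ℕ) : ℝ) := by
      have hL1 : 1 ≤ L := Nat.pos_of_ne_zero (NeZero.ne L)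
      exact_mod_cast (show lev L k ≤ L * lev L k from Nat.le_mul_of_pos_left _ hL1)
    show ‖(if k + 1 = k₀ then _ else 0) - (if k = k₀ then _ else 0)‖ ≤ _
    by_cases h1 : k + 1 = k₀
    · have h2 : ¬ k = k₀ := by omega
      subst h1
      rw [if_pos rfl, if_neg h2, sub_zero, le_div_iff₀ hpos]
      calc ‖V (k + 1) μ i‖ * ((lev L k : ℕ) : ℝ) ≤ α * ((lev L (k + 1) : ℕ) : ℝ) := mul_le_mul (hVb _ _ _) hstep hpos.le hα
        _ ≤ 2 * α * ((lev L (k + 1) : ℕ) : ℝ) := by nlinarith [hpos.le.trans hstep]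
    · by_cases h2 : k = k₀
      · subst h2
        rw [if_neg h1, if_pos rfl, zero_sub, norm_neg, le_div_iff₀ hpos]
        calc ‖V k μ _‖ * ((lev L k : ℕ) : ℝ) ≤ α * ((lev L k : ℕ) : ℝ) := mul_le_mul_of_nonneg_right (hVb _ _ _) hpos.le
          _ ≤ 2 * α * ((lev L k : ℕ) : ℝ) := by nlinarith [hpos.le]
      · rw [if_neg h1, if_neg h2, sub_zero, norm_zero]; positivity

end Slice

/-! ## §2 (L-UD) and the ratio-`1` step envelope for bounded localised families, every coarse volume family -/

section Envelopes

variable (Lb : ℕ) [NeZero Lb] (a : ℝ) (ha : 0 < a)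

/-- **`boundedLegs_envelopes` — THE LEVEL ENVELOPE AND THE TRIVIAL STEP ENVELOPE OF THE INSERTION-WORD LEGS OF A BOUNDED LOCALISED FAMILY, EVERY COARSE VOLUME FAMILY**
[our proof] (`α ≥ 0`, `c₀` arbitrary; dimension `d + 1`): `∃ κ > 0, B ≥ 0` depending on `(d, a, α, c₀)` only such that for EVERY coarse volume family `s`, EVERY family `V_{t,x}` with
`‖V_{t,x}^{(k)}(u)‖ ≤ α` supported where `ρ_{k,x} ≤ c₀`, and all `t, k, x, (q,r)`: `‖Γ_{t,k}(x,(q,r))‖ ≤ B·e^{−κ(distK(x,q) + distK(x,r))}` (PART 198 §3, NO smoothness) and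
`‖(Γ_{t,k+1} − Γ_{t,k})(x,(q,r))‖ ≤ 2B·1^k·e^{−κ(…)}` (triangle inequality — the ratio-`1` step envelope of PART 212's currency). -/
theorem boundedLegs_envelopes (α c₀ : ℝ) (hα : 0 ≤ α) :
    ∃ κ B : ℝ, 0 < κ ∧ 0 ≤ B ∧ ∀ (s : ℕ → ℕ) [∀ t, NeZero (s t)] (V : (t : ℕ) → idx L (fine (Lb * 1) (cubic (d + 1) (s t))) 0 → (k : ℕ) → Fin (d + 1) → (idx L (fine (Lb * 1) (cubic (d + 1) (s t))) k → ℂ)),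
      (∀ t i k μ u, ‖V t i k μ u‖ ≤ α) → (∀ t i k μ u, V t i k μ u ≠ 0 → rho L (fine (Lb * 1) (cubic (d + 1) (s t))) k i u ≤ c₀) →
      (∀ t k x q, ‖(Matrix.of fun (x : idx L (fine (Lb * 1) (cubic (d + 1) (s t))) 0) (q : idx L (fine (Lb * 1) (cubic (d + 1) (s t))) 0 × idx L (fine (Lb * 1) (cubic (d + 1) (s t))) 0) => avgTow (QBlev L (fine (Lb * 1) (cubic (d + 1) (s t)))) ((L : ℝ) ^ (d + 1)) (fun k => calGlev L (fine (Lb * 1) (cubic (d + 1) (s t))) a ha k * Pmodel L (fine (Lb * 1) (cubic (d + 1) (s t))) (V t x) k * calGlev L (fine (Lb * 1) (cubic (d + 1) (s t))) a ha k) k q.1 q.2) x q‖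
        ≤ B * Real.exp (-(κ * (distK L (fine (Lb * 1) (cubic (d + 1) (s t))) x q.1 + distK L (fine (Lb * 1) (cubic (d + 1) (s t))) x q.2)))) ∧
      (∀ t k x q, ‖((Matrix.of fun (x : idx L (fine (Lb * 1) (cubic (d + 1) (s t))) 0) (q : idx L (fine (Lb * 1) (cubic (d + 1) (s t))) 0 × idx L (fine (Lb * 1) (cubic (d + 1) (s t))) 0) => avgTow (QBlev L (fine (Lb * 1) (cubic (d + 1) (s t)))) ((L : ℝ) ^ (d + 1)) (fun k => calGlev L (fine (Lb * 1) (cubic (d + 1) (s t))) a ha k * Pmodel L (fine (Lb * 1) (cubic (d + 1) (s t))) (V t x) k * calGlev L (fine (Lb * 1) (cubic (d + 1) (s t))) a ha k) (k + 1) q.1 q.2)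
          - (Matrix.of fun (x : idx L (fine (Lb * 1) (cubic (d + 1) (s t))) 0) (q : idx L (fine (Lb * 1) (cubic (d + 1) (s t))) 0 × idx L (fine (Lb * 1) (cubic (d + 1) (s t))) 0) => avgTow (QBlev L (fine (Lb * 1) (cubic (d + 1) (s t)))) ((L : ℝ) ^ (d + 1)) (fun k => calGlev L (fine (Lb * 1) (cubic (d + 1) (s t))) a ha k * Pmodel L (fine (Lb * 1) (cubic (d + 1) (s t))) (V t x) k * calGlev L (fine (Lb * 1) (cubic (d + 1) (s t))) a ha k) k q.1 q.2)) x q‖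
        ≤ 2 * B * (1 : ℝ) ^ k * Real.exp (-(κ * (distK L (fine (Lb * 1) (cubic (d + 1) (s t))) x q.1 + distK L (fine (Lb * 1) (cubic (d + 1) (s t))) x q.2)))) := by
  obtain ⟨κ, B, hκ, hB, h⟩ := exists_twoPoint_insertion L a ha (d := d + 1) α c₀ hα
  refine ⟨κ, B, hκ, hB, fun s _ V hVb hloc => ?_⟩
  have henv : ∀ t k x (q : idx L (fine (Lb * 1) (cubic (d + 1) (s t))) 0 × idx L (fine (Lb * 1) (cubic (d + 1) (s t))) 0), ‖(Matrix.of fun (x : idx L (fine (Lb * 1) (cubic (d + 1) (s t))) 0) (q : idx L (fine (Lb * 1) (cubic (d + 1) (s t))) 0 × idx L (fine (Lb * 1) (cubic (d + 1) (s t))) 0) => avgTow (QBlev L (fine (Lb * 1) (cubic (d + 1) (s t)))) ((L : ℝ) ^ (d + 1)) (fun k => calGlev L (fine (Lb * 1) (cubic (d + 1) (s t))) a ha k * Pmodel L (fine (Lb * 1) (cubic (d + 1) (s t))) (V t x) k * calGlev L (fine (Lb * 1) (cubic (d + 1) (s t))) a ha k) k q.1 q.2) x q‖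
      ≤ B * Real.exp (-(κ * (distK L (fine (Lb * 1) (cubic (d + 1) (s t))) x q.1 + distK L (fine (Lb * 1) (cubic (d + 1) (s t))) x q.2))) := by
    intro t k x q
    rw [Matrix.of_apply, distK_comm L _ x q.1, distK_comm L _ x q.2]
    exact h (fine (Lb * 1) (cubic (d + 1) (s t))) x (V t x) (hVb t x) (hloc t x) k q.1 q.2
  refine ⟨henv, fun t k x q => ?_⟩
  rw [Matrix.sub_apply]
  calc _ ≤ ‖(Matrix.of fun (x : idx L (fine (Lb * 1) (cubic (d + 1) (s t))) 0) (q : idx L (fine (Lb * 1) (cubic (d + 1) (s t))) 0 × idx L (fine (Lb * 1) (cubic (d + 1) (s t))) 0) => avgTow (QBlev L (fine (Lb * 1) (cubic (d + 1) (s t)))) ((L : ℝ) ^ (d + 1)) (fun k => calGlev L (fine (Lb * 1) (cubic (d + 1) (s t))) a ha k * Pmodel L (fine (Lb * 1) (cubic (d + 1) (s t))) (V t x) k * calGlev L (fine (Lb * 1) (cubic (d + 1) (s t))) a ha k) (k + 1) q.1 q.2) x q‖ + ‖(Matrix.of fun (x : idx L (fine (Lb * 1) (cubic (d + 1) (s t)))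 0) (q : idx L (fine (Lb * 1) (cubic (d + 1) (s t))) 0 × idx L (fine (Lb * 1) (cubic (d + 1) (s t))) 0) => avgTow (QBlev L (fine (Lb * 1) (cubic (d + 1) (s t)))) ((L : ℝ) ^ (d + 1)) (fun k => calGlev L (fine (Lb * 1) (cubic (d + 1) (s t))) a ha k * Pmodel L (fine (Lb * 1) (cubic (d + 1) (s t))) (V t x) k * calGlev L (fine (Lb * 1) (cubic (d + 1) (s t))) a ha k) k q.1 q.2) x q‖ := norm_sub_le _ _
    _ ≤ B * Real.exp (-(κ * (distK L (fine (Lb * 1) (cubic (d + 1) (s t))) x q.1 + distK L (fine (Lb * 1) (cubic (d + 1) (s t))) x q.2))) + B * Real.exp (-(κ * (distK L (fine (Lb * 1) (cubic (d + 1) (s t))) x q.1 + distK L (fine (Lb * 1) (cubic (d + 1) (s t))) x q.2))) :=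
        add_le_add (henv t (k + 1) x q) (henv t k x q)
    _ = _ := by rw [one_pow]; ring

end Envelopes

/-! ## §3 EL₃ of the legs at level `k` from EL₁ of the bounded backgrounds at level `k` (the slice trick) -/

section Limits

variable (Lb : ℕ) [NeZero Lb] (a : ℝ) (ha : 0 < a)

/-- **`boundedLegs_tendsto` — EL₃ OF THE INSERTION-WORD LEGS OF A BOUNDED FAMILY AT LEVEL `k`, MODULO EL₁ OF THE BACKGROUNDS AT LEVEL `k` ABOUT INTEGER ROOTS** [our proof]
(`d + 1 ≥ 3`, coarse volumes `2(t+1)`, `‖V‖ ≤ α`): PART 200's `insertionLegs_tendsto` applied to the family of level-`k` SLICES (Lipschitz with `(α, 2α·n_k)` by §1; their readings at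
levels `≠ k` are `0`), then `word_slice`.  NO smoothness of `V`. [cite: Balaban1987RG1, p.264 (after (1.21): the `T ↗ ℤ^d` limit)] -/
theorem boundedLegs_tendsto (hd : 2 ≤ d) {α : ℝ} (hα : 0 ≤ α) {V : (t : ℕ) → idx L (fine (Lb * 1) (cubic (d + 1) (evenPeriod t))) 0 → (k : ℕ) → Fin (d + 1) → (idx L (fine (Lb * 1) (cubic (d + 1) (evenPeriod t))) k → ℂ)}
    (hVb : ∀ t i k μ u, ‖V t i k μ u‖ ≤ α) (k : ℕ)
    (hel : ∀ (z : Fin (d + 1) → ℤ) (μ' : Fin (d + 1)) (μ f : Fin (d + 1)) (w : Fin (d + 1) → ℤ), ∃ s : ℂ,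
      Tendsto (fun t => V t ((unitIdx L (fine (Lb * 1) (cubic (d + 1) (evenPeriod t)))).symm (castT (fine (Lb * 1) (cubic (d + 1) (evenPeriod t))) z, μ')) k μ (castT (fine (lev L k) (fine (Lb * 1) (cubic (d + 1) (evenPeriod t)))) w, f)) atTop (𝓝 s)) (μ' l l' : Fin (d + 1)) (z u v : Fin (d + 1) → ℤ) :
    ∃ s' : ℂ, Tendsto (fun t => (Matrix.of fun (x : idx L (fine (Lb * 1) (cubic (d + 1) (evenPeriod t))) 0) (q : idx L (fine (Lb * 1) (cubic (d + 1) (evenPeriod t))) 0 × idx L (fine (Lb * 1) (cubic (d + 1) (evenPeriod t))) 0) => avgTow (QBlev L (fine (Lb * 1) (cubic (d + 1) (evenPeriod t)))) ((L : ℝ) ^ (d + 1)) (fun k => calGlev L (fine (Lb * 1) (cubic (d + 1) (evenPeriod t))) a ha k * Pmodel L (fine (Lb * 1) (cubic (d + 1) (evenPeriod t))) (V t x) k * calGlev L (fine (Lb * 1) (cubic (d + 1) (evenPeriod t))) a ha k) k q.1 q.2)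
      ((unitIdx L (fine (Lb * 1) (cubic (d + 1) (evenPeriod t)))).symm (castT (fine (Lb * 1) (cubic (d + 1) (evenPeriod t))) z, μ')) (((unitIdx L (fine (Lb * 1) (cubic (d + 1) (evenPeriod t)))).symm (castT (fine (Lb * 1) (cubic (d + 1) (evenPeriod t))) u, l)), ((unitIdx L (fine (Lb * 1) (cubic (d + 1) (evenPeriod t)))).symm (castT (fine (Lb * 1) (cubic (d + 1) (evenPeriod t))) v, l')))) atTop (𝓝 s') := by
  have hVs : ∀ t i, LipschitzBackground L (fine (Lb * 1) (cubic (d + 1) (evenPeriod t))) (fun k' μ u => if k' = k then V t i k' μ u else 0) α (2 * α * (lev L k : ℕ)) :=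
    fun t i => lipschitzBackground_slice L (fine (Lb * 1) (cubic (d + 1) (evenPeriod t))) hα (hVb t i) k
  have hels : ∀ (z : Fin (d + 1) → ℤ) (μ' : Fin (d + 1)) (k' : ℕ) (μ f : Fin (d + 1)) (w : Fin (d + 1) → ℤ), ∃ s : ℂ,
      Tendsto (fun t => (fun k' μ u => if k' = k then V t ((unitIdx L (fine (Lb * 1) (cubic (d + 1) (evenPeriod t)))).symm (castT (fine (Lb * 1) (cubic (d + 1) (evenPeriod t))) z, μ')) k' μ u else 0) k' μ (castT (fine (lev L k') (fine (Lb * 1) (cubic (d + 1) (evenPeriod t)))) w, f)) atTop (𝓝 s) := by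
    intro z μ' k' μ f w
    by_cases hk : k' = k
    · subst hk
      obtain ⟨s, hs⟩ := hel z μ' μ f w
      exact ⟨s, hs.congr fun t => by simp only [if_true]⟩
    · exact ⟨0, tendsto_const_nhds.congr fun t => by simp only [hk, if_false]⟩
  obtain ⟨s', hs'⟩ := insertionLegs_tendsto L Lb a ha hd (V := fun t i => (fun k' μ u => if k' = k then V t i k' μ u else 0)) hVs hels k μ' l l' z u v
  refine ⟨s', hs'.congr fun t => ?_⟩
  simp only [Matrix.of_apply]
  rw [word_slice]

end Limits

/-! ## §4 The indicator 1-forms: bounded, localised, pointwise limits about every integer root -/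

section Indicator

variable {D : ℕ} {side : ℕ → ℕ}

/-- the indicator family is bounded by `1`. [folklore] -/
theorem indicator_bound {V : (t : ℕ) → idx L (cubic D (side t)) 0 → (k : ℕ) → Fin D → (idx L (cubic D (side t)) k → ℂ)}
    (hVdef : ∀ t x k μ u, V t x k μ u = if μ = x.2 then (if rho L (cubic D (side t)) k x u ≤ 0 then 1 else 0) else 0) (t : ℕ) (x : idx L (cubic D (side t)) 0) (k : ℕ)
    (μ : Fin D) (u : idx L (cubic D (side t)) k) : ‖V t x k μ u‖ ≤ 1 := by
  rw [hVdef]; split_ifs <;> simp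

/-- the indicator family is supported where `ρ_{k,x} ≤ 0`. [folklore] -/
theorem indicator_loc {V : (t : ℕ) → idx L (cubic D (side t)) 0 → (k : ℕ) → Fin D → (idx L (cubic D (side t)) k → ℂ)}
    (hVdef : ∀ t x k μ u, V t x k μ u = if μ = x.2 then (if rho L (cubic D (side t)) k x u ≤ 0 then 1 else 0) else 0) (t : ℕ) (x : idx L (cubic D (side t)) 0) (k : ℕ)
    (μ : Fin D) (u : idx L (cubic D (side t)) k) (h : V t x k μ u ≠ 0) : rho L (cubic D (side t)) k x u ≤ 0 := by
  rw [hVdef] at h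
  by_contra hρ
  exact h (by rw [if_neg hρ]; split_ifs <;> rfl)

/-- **`tendsto_indicator_reading` — EL₁ OF THE INDICATOR FAMILY ABOUT INTEGER ROOTS** [our proof] (ANY cubic side sequence `side t → ∞`; the family DISPLAYED as a hypothesis): for all
integer `z, w`, all `μ′, k, μ, f`, the reading `V_{t, e(ẑ_t, μ′)}^{(k)}{}_μ(ŵ_t, f)` converges — it is eventually the constant `[μ = μ′]·𝟙[‖w − n_kz‖_∞∕n_k − 1 ≤ 0]` (`ctr_unitIdx_symm_castT` +
PART 192's `tdist_castT_eventually` on the fine torus of side `n_k·side t`; PART 202's proof for the tent, verbatim up to the profile). -/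
theorem tendsto_indicator_reading [∀ t, NeZero (side t)] (hside : Tendsto side atTop atTop)
    {V : (t : ℕ) → idx L (cubic D (side t)) 0 → (k : ℕ) → Fin D → (idx L (cubic D (side t)) k → ℂ)}
    (hVdef : ∀ t x k μ u, V t x k μ u = if μ = x.2 then (if rho L (cubic D (side t)) k x u ≤ 0 then 1 else 0) else 0)
    (z : Fin D → ℤ) (μ' : Fin D) (k : ℕ) (μ f : Fin D) (w : Fin D → ℤ) :
    ∃ s : ℂ, Tendsto (fun t => V t ((unitIdx L (cubic D (side t))).symm (castT (cubic D (side t)) z, μ')) k μ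
      (castT (fine (lev L k) (cubic D (side t))) w, f)) atTop (𝓝 s) := by
  by_cases hμ : μ = μ'
  · have hside' : Tendsto (fun t => lev L k * side t) atTop atTop :=
      Filter.Tendsto.const_mul_atTop' (Nat.pos_of_ne_zero (NeZero.ne (lev L k))) hside
    refine ⟨(if (((supNorm (w - fun i => ((lev L k : ℕ) : ℤ) * z i) : ℕ) : ℝ) / (lev L k : ℝ)) - 1 ≤ 0 then (1 : ℂ) else 0), tendsto_const_nhds.congr' ?_⟩
    filter_upwards [tdist_castT_eventually (d := D) (side := fun t => lev L k * side t) hside' (fun i => ((lev L k : ℕ) : ℤ) * z i) w] with t ht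
    have ht' : tdist (castT (fine (lev L k) (cubic D (side t))) (fun i => ((lev L k : ℕ) : ℤ) * z i)) (castT (fine (lev L k) (cubic D (side t))) w)
        = supNorm (w - fun i => ((lev L k : ℕ) : ℤ) * z i) := ht
    rw [hVdef, unitIdx_symm_snd, if_pos hμ, rho_apply]
    unfold rhoSite
    rw [ctr_unitIdx_symm_castT, ht']
  · exact ⟨0, tendsto_const_nhds.congr fun t => by rw [hVdef, unitIdx_symm_snd, if_neg hμ]⟩

end Indicator

end Summit.QuantumFields.BalabanUV.Beta.GAN24.BoundedBackgroundLegs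

end
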